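/-
Copyright (c) 2026. All rights reserved.
Released under Apache 2.0 license as described in the file LICENSE.
Authors: abc-iut cell, campaign-S prover seat abc-iut-S8 (wave 2).
-/
import Mathlib.Analysis.SpecialFunctions.Log.Basic
import Mathlib.Algebra.Order.Floor.Defs
import Mathlib.Algebra.BigOperators.Ring.Finset
import Mathlib.Algebra.Order.BigOperators.Group.Finset
import Literature.IUT.LogVolume.RamificationInvariants
import HarnessLib

/-!
# [IUTchIV] Proposition 1.4 (iii): the elementary inequalities on `a_i`, `b_i`, `d_i` and the
# real-arithmetic assembly of its two displayed log-volume bounds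

Mochizuki, *Inter-universal Teichmüller theory IV*, RIMS manuscript (Apr. 2020; = PRIMS **57** (2021)),
§1, Proposition 1.4 (iii), kurims p. 13, and its proof, p. 14.  With the notation of Propositions 1.1,
1.2 (`e_i` the ramification index of `k_i/ℚ_p`, `d_i` the order of the different, `a_i`, `b_i` the
exponents of Prop. 1.2 = `logRadiusA p e_i`, `logRadiusB p e_i` of `RamificationInvariants.lean`,
`d_I = Σ d_i`, `a_I = Σ a_i`, `b_I = Σ b_i`) and "`I* ⊆ I` a subset such that for each `i ∈ I ∖ I*`, it
holds that `p − 2 ≥ e_i (≥ 1)`", Prop. 1.4 (iii) asserts, for `λ ∈ (1/e_{i†})·ℤ`, the inclusions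
`φ(p^λ·(R_I)^~) ⊆ p^{⌊λ−d_I−a_I⌋}·log_p(R_I^×) ⊆ p^{⌊λ−d_I−a_I−b_I⌋}·(R_I)^~` [= Prop. 1.2 (ii)] "and
inequalities
  `μ^log(p^{⌊λ−d_I−a_I⌋}·log_p(R_I^×)) ≤ {−λ + d_I + 1 + 4·|I*|/p}·log(p)`;
  `μ^log(p^{⌊λ−d_I−a_I−b_I⌋}·(R_I)^~) ≤ {−λ + d_I + 1}·log(p) + Σ_{i∈I*} {3 + log(e_i)}`
… Moreover, `d_I + a_I ≥ |I|` if `p > 2`; `d_I + a_I ≥ 2·|I|` if `p = 2`."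

## What this file proves (everything; no named fact)

The printed proof (p. 14) reduces the two inequalities to (a) the normalisations of Prop. 1.4 (i)
(`μ^log(R_I) ≤ μ^log((R_I)^~) = 0`, `μ^log(p^n·A) = −n·log(p) + μ^log(A)`), (b) the consequence
`μ^log(log_p(R_i^×)) ≤ −(1/e_i)·log(p)` of Prop. 1.4 (ii) together with
`μ^log(log_p(R_I^×)) = Σ_i μ^log(log_p(R_i^×)) + μ^log(R_I)`, and (c) the following ELEMENTARY
INEQUALITIES on the exponents, which are proved here exactly as printed:
* `one_div_le_logRadiusA`: "`a_i ≥ 1/e_i`";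
* `logRadiusA_sub_one_div_le`: "`a_i − 1/e_i ≤ 4/p`"; `four_div_mul_log_le_two`: "`4/p ≤ 2/log(p)`",
  i.e. `(4/p)·log(p) ≤ 2`;
* `logRadiusB_add_one_div_mul_log_le`, `log_two_mul_le_one_add_log`:
  "`(b_i + 1/e_i)·log(p) ≤ log(2e_i) ≤ 1 + log(e_i)`";
* `logRadius_add_mul_log_le`: hence `(a_i + b_i)·log(p) ≤ 3 + log(e_i)`, while for `i ∈ I ∖ I*`
  "`a_i = 1/e_i = −b_i`" (`logRadiusA_eq`, `logRadiusB_eq` of `RamificationInvariants.lean`);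
* `one_le_add_logRadiusA`, `two_le_add_logRadiusA_two`: "since `d_i ≥ (e_i − 1)/e_i` [Prop. 1.3 (i)],
  we conclude that `d_i + a_i ≥ 1`" (`p > 2`), and `d_i + a_i ≥ 2` if `p = 2`;
and their sums over `I` (`sum_logRadiusA_sub_le` = "`Σ_{i∈I} (a_i − 1/e_i) ≤ 4·|I*|/p`",
`sum_logRadius_mul_log_le`, `card_le_sum_add_logRadiusA` = "`d_I + a_I ≥ |I|`",
`two_mul_card_le_sum_add_logRadiusA_two` = "`d_I + a_I ≥ 2·|I|`").
Finally `logVolume_bound_one` and `logVolume_bound_two` carry out the displayed computation of p. 14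
("Now we compute: …") as REAL ARITHMETIC: from per-factor log-volume inputs `v_i ≤ −(1/e_i)·log(p)`
(= (b)), `μ^log(R_I) ≤ 0` and `μ^log((R_I)^~) ≤ 0` (= (a)) they yield the two right-hand sides verbatim.
The measure-theoretic identification of the left-hand sides with log-volumes of subsets of the tensor
packet `⊗ k_i` (Prop. 1.4 (i), the cell's `PacketVolume.lean` / `TensorPacketRing.lean`) is NOT done in
this file; nor is Prop. 1.4 (ii), nor any statement about [IUTchIII] Cor. 3.12.  The content is
classical real arithmetic; the [IUTchIV] locators record WHICH printed lines are being kernel-checked.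
-/

noncomputable section

open Finset

namespace Literature.IUT.LogVolume

/-! ## One tensor factor: the exponents `a = logRadiusA p e`, `b = logRadiusB p e` -/

section OneFactor

variable {p e : ℕ}

/-- "`a_i ≥ 1/e_i`, for all `i ∈ I`" (proof of Prop. 1.4 (iii), p. 14; printed for `p > 2`, where
`a_i = (1/e_i)·⌈e_i/(p−2)⌉` with `⌈e_i/(p−2)⌉ ≥ 1`; for `p = 2`, `a_i = 2 ≥ 1/e_i` as well).
[cite: Mochizuki2012, IUTchIV Prop. 1.4 (iii) proof p. 14] -/
theorem one_div_le_logRadiusA (hp : p.Prime) (he : 1 ≤ e) : 1 / (e : ℝ) ≤ logRadiusA p e := by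
  have he1 : (1 : ℝ) ≤ e := by exact_mod_cast he
  have he0 : (0 : ℝ) < e := by linarith
  unfold logRadiusA
  split_ifs with h2
  · calc 1 / (e : ℝ) ≤ 1 := by rw [div_le_one he0]; exact he1
      _ ≤ 2 := by norm_num
  · have h3 : 3 ≤ p := by have := hp.two_le; omega
    have hp2 : (0 : ℝ) < (p : ℝ) - 2 := by
      have : (3 : ℝ) ≤ p := by exact_mod_cast h3
      linarith
    have hceil : (1 : ℝ) ≤ (⌈(e : ℝ) / ((p : ℝ) - 2)⌉ : ℝ) := by
      have h0 : 0 < ⌈(e : ℝ) / ((p : ℝ) - 2)⌉ := Int.ceil_pos.mpr (div_pos he0 hp2)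
      have h1 : (1 : ℤ) ≤ ⌈(e : ℝ) / ((p : ℝ) - 2)⌉ := h0
      exact_mod_cast h1
    exact div_le_div_of_nonneg_right hceil he0.le

/-- "`a_i − 1/e_i ≤ 4/p`" (proof of Prop. 1.4 (iii), p. 14): for `p > 2`,
`a_i − 1/e_i = (⌈e_i/(p−2)⌉ − 1)/e_i < 1/(p−2) ≤ 4/p`; for `p = 2`, `a_i − 1/e_i ≤ 2 = 4/p`.
[cite: Mochizuki2012, IUTchIV Prop. 1.4 (iii) proof p. 14] -/
theorem logRadiusA_sub_one_div_le (hp : p.Prime) (he : 1 ≤ e) :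
    logRadiusA p e - 1 / (e : ℝ) ≤ 4 / (p : ℝ) := by
  have he1 : (1 : ℝ) ≤ e := by exact_mod_cast he
  have he0 : (0 : ℝ) < e := by linarith
  unfold logRadiusA
  split_ifs with h2
  · subst h2
    have : 0 ≤ 1 / (e : ℝ) := by positivity
    have h4 : (4 : ℝ) / ((2 : ℕ) : ℝ) = 2 := by norm_num
    rw [h4]
    linarith
  · have h3 : 3 ≤ p := by have := hp.two_le; omega
    have hp3 : (3 : ℝ) ≤ p := by exact_mod_cast h3
    have hp0 : (0 : ℝ) < p := by linarith
    have hp2 : (0 : ℝ) < (p : ℝ) - 2 := by linarith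
    have hx : (⌈(e : ℝ) / ((p : ℝ) - 2)⌉ : ℝ) < (e : ℝ) / ((p : ℝ) - 2) + 1 := Int.ceil_lt_add_one _
    calc (⌈(e : ℝ) / ((p : ℝ) - 2)⌉ : ℝ) / e - 1 / e
        = ((⌈(e : ℝ) / ((p : ℝ) - 2)⌉ : ℝ) - 1) / e := by ring
      _ ≤ ((e : ℝ) / ((p : ℝ) - 2)) / e := by
          apply div_le_div_of_nonneg_right _ he0.le
          linarith
      _ = 1 / ((p : ℝ) - 2) := by
          field_simp
      _ ≤ 4 / (p : ℝ) := by
          rw [div_le_div_iff₀ hp2 hp0]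
          linarith

/-- "`4/p ≤ 2/log(p)`", i.e. `(4/p)·log(p) ≤ 2`, for every `p ≥ 2` (proof of Prop. 1.4 (iii), p. 14):
indeed `log(p) = log 2 + log(p/2) ≤ 1 + (p/2 − 1) = p/2`.
[cite: Mochizuki2012, IUTchIV Prop. 1.4 (iii) proof p. 14] -/
theorem four_div_mul_log_le_two (hp : 2 ≤ p) : 4 / (p : ℝ) * Real.log p ≤ 2 := by
  have hp2 : (2 : ℝ) ≤ p := by exact_mod_cast hp
  have hp0 : (0 : ℝ) < p := by linarith
  have hlog : Real.log p ≤ (p : ℝ) / 2 := by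
    have h1 : Real.log 2 ≤ 2 - 1 := Real.log_le_sub_one_of_pos two_pos
    have h2 : Real.log ((p : ℝ) / 2) ≤ (p : ℝ) / 2 - 1 := Real.log_le_sub_one_of_pos (by positivity)
    have h3 : Real.log p = Real.log 2 + Real.log ((p : ℝ) / 2) := by
      rw [← Real.log_mul two_ne_zero (by positivity)]
      congr 1
      ring
    linarith
  calc 4 / (p : ℝ) * Real.log p ≤ 4 / (p : ℝ) * ((p : ℝ) / 2) := by gcongr
    _ = 2 := by field_simp; ring

/-- "`(b_i + 1/e_i)·log(p) ≤ log(2e_i)`" (proof of Prop. 1.4 (iii), p. 14): `b_i + 1/e_i =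
⌊log(p·e_i/(p−1))/log(p)⌋ ≤ log(p·e_i/(p−1))/log(p)` and `p/(p−1) ≤ 2`.
[cite: Mochizuki2012, IUTchIV Prop. 1.4 (iii) proof p. 14] -/
theorem logRadiusB_add_one_div_mul_log_le (hp : 2 ≤ p) (he : 1 ≤ e) :
    (logRadiusB p e + 1 / (e : ℝ)) * Real.log p ≤ Real.log (2 * e) := by
  have hp2 : (2 : ℝ) ≤ p := by exact_mod_cast hp
  have hp1 : (0 : ℝ) < (p : ℝ) - 1 := by linarith
  have he1 : (1 : ℝ) ≤ e := by exact_mod_cast he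
  have he0 : (0 : ℝ) < e := by linarith
  have hlogp : 0 < Real.log p := Real.log_pos (by linarith)
  set L : ℝ := Real.log ((p : ℝ) * e / ((p : ℝ) - 1)) with hL
  have hb : logRadiusB p e + 1 / (e : ℝ) = (⌊L / Real.log p⌋ : ℝ) := by
    rw [logRadiusB, ← hL]
    ring
  rw [hb]
  have harg : 0 < (p : ℝ) * e / ((p : ℝ) - 1) := by positivity
  calc (⌊L / Real.log p⌋ : ℝ) * Real.log p ≤ (L / Real.log p) * Real.log p := by
        gcongr
        exact Int.floor_le _
    _ = L := div_mul_cancel₀ _ hlogp.ne'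
    _ ≤ Real.log (2 * e) := by
        apply Real.log_le_log harg
        rw [div_le_iff₀ hp1]
        nlinarith

/-- "`log(2e_i) ≤ 1 + log(e_i)`" (proof of Prop. 1.4 (iii), p. 14): `log 2 ≤ 1`.
[cite: Mochizuki2012, IUTchIV Prop. 1.4 (iii) proof p. 14] -/
theorem log_two_mul_le_one_add_log (he : 1 ≤ e) : Real.log (2 * e) ≤ 1 + Real.log e := by
  have he0 : (e : ℝ) ≠ 0 := by
    have : (1 : ℝ) ≤ e := by exact_mod_cast he
    positivity
  rw [Real.log_mul two_ne_zero he0]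
  have : Real.log 2 ≤ 2 - 1 := Real.log_le_sub_one_of_pos two_pos
  linarith

/-- The per-factor bound used for `i ∈ I*` in the second displayed inequality of Prop. 1.4 (iii):
`(a_i + b_i)·log(p) = (a_i − 1/e_i)·log(p) + (b_i + 1/e_i)·log(p) ≤ 2 + 1 + log(e_i) = 3 + log(e_i)`
(proof p. 14). [cite: Mochizuki2012, IUTchIV Prop. 1.4 (iii) proof p. 14] -/
theorem logRadius_add_mul_log_le (hp : p.Prime) (he : 1 ≤ e) :
    (logRadiusA p e + logRadiusB p e) * Real.log p ≤ 3 + Real.log e := by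
  have h1 := logRadiusA_sub_one_div_le hp he
  have h2 := four_div_mul_log_le_two hp.two_le
  have h3 := logRadiusB_add_one_div_mul_log_le hp.two_le he
  have h4 := log_two_mul_le_one_add_log he
  have hlogp : 0 ≤ Real.log p := Real.log_nonneg (by exact_mod_cast hp.one_lt.le)
  have h5 : (logRadiusA p e - 1 / (e : ℝ)) * Real.log p ≤ 4 / (p : ℝ) * Real.log p :=
    mul_le_mul_of_nonneg_right h1 hlogp
  have hsplit : (logRadiusA p e + logRadiusB p e) * Real.log p
      = (logRadiusA p e - 1 / (e : ℝ)) * Real.log p + (logRadiusB p e + 1 / (e : ℝ)) * Real.log p := by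
    ring
  rw [hsplit]
  linarith

/-- For `i ∈ I ∖ I*` (i.e. `p − 2 ≥ e_i ≥ 1`, forcing `p > 2`): "`a_i = 1/e_i = −b_i`", so
`a_i − 1/e_i = 0` and `a_i + b_i = 0` (proof of Prop. 1.4 (iii), p. 14).
[cite: Mochizuki2012, IUTchIV Prop. 1.4 (iii) proof p. 14] -/
theorem logRadius_eq_of_le_sub_two (hp : p.Prime) (he : 1 ≤ e) (htame : e ≤ p - 2) :
    logRadiusA p e - 1 / (e : ℝ) = 0 ∧ logRadiusA p e + logRadiusB p e = 0 := by
  have hp2 : 2 < p := by have := hp.two_le; omega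
  rw [logRadiusA_eq hp2 he htame, logRadiusB_eq hp2 he htame]
  constructor <;> ring

/-- "since `d_i ≥ (e_i − 1)/e_i` for all `i ∈ I` [cf. Proposition 1.3, (i)], we conclude that
`d_i + a_i ≥ 1`" (proof of Prop. 1.4 (iii), p. 14; printed for `p > 2`, true for every prime since
`a_i ≥ 1/e_i` always).  The hypothesis `d ≥ (e−1)/e` is Prop. 1.3 (i) with `k_0 = ℚ_p`, taken as an
input here. [cite: Mochizuki2012, IUTchIV Prop. 1.4 (iii) proof p. 14] -/
theorem one_le_add_logRadiusA (hp : p.Prime) (he : 1 ≤ e) {d : ℝ} (hd : ((e : ℝ) - 1) / e ≤ d) :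
    1 ≤ d + logRadiusA p e := by
  have ha := one_div_le_logRadiusA hp he
  have he0 : (e : ℝ) ≠ 0 := by
    have : (1 : ℝ) ≤ e := by exact_mod_cast he
    positivity
  have : ((e : ℝ) - 1) / e + 1 / e = 1 := by
    field_simp
    ring
  linarith

/-- "When `p = 2`, the fact that `d_I + a_I ≥ 2·|I|` follows immediately from the definition of `d_i`
and `a_i`" (proof of Prop. 1.4 (iii), p. 14): per factor, `d_i ≥ 0` and `a_i = 2`.
[cite: Mochizuki2012, IUTchIV Prop. 1.4 (iii) proof p. 14] -/
theorem two_le_add_logRadiusA_two (e : ℕ) {d : ℝ} (hd : 0 ≤ d) : 2 ≤ d + logRadiusA 2 e := by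
  simp only [logRadiusA, if_true]
  linarith

end OneFactor

/-! ## Sums over the index set `I` (with the exceptional subset `I* ⊆ I`) -/

section Sums

variable {ι : Type*} {p : ℕ} (I Istar : Finset ι) (e : ι → ℕ)

/-- "`Σ_{i∈I} (a_i − 1/e_i) ≤ 4·|I*|/p`": the step
`{−λ + d_I + 1 + Σ_{i∈I}(a_i − 1/e_i)}·log(p) ≤ {−λ + d_I + 1 + 4·|I*|/p}·log(p)` of the proof of
Prop. 1.4 (iii), p. 14 (`a_i − 1/e_i ≤ 4/p` on `I*`, `= 0` off `I*`).
[cite: Mochizuki2012, IUTchIV Prop. 1.4 (iii) proof p. 14] -/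
theorem sum_logRadiusA_sub_le (hp : p.Prime) (he : ∀ i ∈ I, 1 ≤ e i) (hIstar : Istar ⊆ I)
    (htame : ∀ i ∈ I, i ∉ Istar → e i ≤ p - 2) :
    ∑ i ∈ I, (logRadiusA p (e i) - 1 / (e i : ℝ)) ≤ 4 * (Istar.card : ℝ) / p := by
  classical
  have key : ∀ i ∈ I,
      logRadiusA p (e i) - 1 / (e i : ℝ) ≤ if i ∈ Istar then 4 / (p : ℝ) else 0 := by
    intro i hi
    split_ifs with h
    · exact logRadiusA_sub_one_div_le hp (he i hi)
    · exact (logRadius_eq_of_le_sub_two hp (he i hi) (htame i hi h)).1.le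
  calc ∑ i ∈ I, (logRadiusA p (e i) - 1 / (e i : ℝ))
      ≤ ∑ i ∈ I, (if i ∈ Istar then 4 / (p : ℝ) else 0) := Finset.sum_le_sum key
    _ = ∑ i ∈ Istar, (4 / (p : ℝ)) := by
        rw [Finset.sum_ite_mem, Finset.inter_eq_right.mpr hIstar]
    _ = 4 * (Istar.card : ℝ) / p := by
        rw [Finset.sum_const, nsmul_eq_mul]
        ring

/-- "`(a_I + b_I)·log(p) ≤ Σ_{i∈I*} {3 + log(e_i)}`": the step from `{−λ + d_I + a_I + b_I + 1}·log(p)`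
to `{−λ + d_I + 1}·log(p) + Σ_{i∈I*} {3 + log(e_i)}` of the proof of Prop. 1.4 (iii), p. 14.
[cite: Mochizuki2012, IUTchIV Prop. 1.4 (iii) proof p. 14] -/
theorem sum_logRadius_mul_log_le (hp : p.Prime) (he : ∀ i ∈ I, 1 ≤ e i) (hIstar : Istar ⊆ I)
    (htame : ∀ i ∈ I, i ∉ Istar → e i ≤ p - 2) :
    (∑ i ∈ I, (logRadiusA p (e i) + logRadiusB p (e i))) * Real.log p
      ≤ ∑ i ∈ Istar, (3 + Real.log (e i)) := by
  classical
  have key : ∀ i ∈ I, (logRadiusA p (e i) + logRadiusB p (e i)) * Real.log p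
      ≤ if i ∈ Istar then 3 + Real.log (e i) else 0 := by
    intro i hi
    split_ifs with h
    · exact logRadius_add_mul_log_le hp (he i hi)
    · rw [(logRadius_eq_of_le_sub_two hp (he i hi) (htame i hi h)).2, zero_mul]
  calc (∑ i ∈ I, (logRadiusA p (e i) + logRadiusB p (e i))) * Real.log p
      = ∑ i ∈ I, (logRadiusA p (e i) + logRadiusB p (e i)) * Real.log p := Finset.sum_mul _ _ _
    _ ≤ ∑ i ∈ I, (if i ∈ Istar then 3 + Real.log (e i) else 0) := Finset.sum_le_sum key
    _ = ∑ i ∈ Istar, (3 + Real.log (e i)) := by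
        rw [Finset.sum_ite_mem, Finset.inter_eq_right.mpr hIstar]

/-- "**`d_I + a_I ≥ |I|` if `p > 2`**" (Prop. 1.4 (iii), p. 13; proof p. 14 via `d_i + a_i ≥ 1`), with
the different bound `d_i ≥ (e_i − 1)/e_i` (Prop. 1.3 (i)) as input; valid for every prime `p`.
[cite: Mochizuki2012, IUTchIV Prop. 1.4 (iii) p. 13] -/
theorem card_le_sum_add_logRadiusA (hp : p.Prime) (he : ∀ i ∈ I, 1 ≤ e i) (d : ι → ℝ)
    (hd : ∀ i ∈ I, ((e i : ℝ) - 1) / (e i) ≤ d i) :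
    (I.card : ℝ) ≤ ∑ i ∈ I, (d i + logRadiusA p (e i)) := by
  calc (I.card : ℝ) = ∑ i ∈ I, (1 : ℝ) := by simp
    _ ≤ ∑ i ∈ I, (d i + logRadiusA p (e i)) :=
        Finset.sum_le_sum fun i hi => one_le_add_logRadiusA hp (he i hi) (hd i hi)

/-- "**`d_I + a_I ≥ 2·|I|` if `p = 2`**" (Prop. 1.4 (iii), p. 13; proof p. 14), with `d_i ≥ 0` as input.
[cite: Mochizuki2012, IUTchIV Prop. 1.4 (iii) p. 13] -/
theorem two_mul_card_le_sum_add_logRadiusA_two (d : ι → ℝ) (hd : ∀ i ∈ I, 0 ≤ d i) :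
    2 * (I.card : ℝ) ≤ ∑ i ∈ I, (d i + logRadiusA 2 (e i)) := by
  calc 2 * (I.card : ℝ) = ∑ i ∈ I, (2 : ℝ) := by simp [mul_comm]
    _ ≤ ∑ i ∈ I, (d i + logRadiusA 2 (e i)) :=
        Finset.sum_le_sum fun i hi => two_le_add_logRadiusA_two (e i) (hd i hi)

/-! ## "Now we compute" (p. 14): the two displayed inequalities as real arithmetic

In both computations `μ^log(p^n · A) = −n·log(p) + μ^log(A)` turns the exponent into the term
`−⌊…⌋·log(p) ≤ (−(…) + 1)·log(p)`. -/

/-- `−⌊x⌋ ≤ −x + 1` ("the definition of `⌊−⌋`", p. 9). [folklore] -/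
private theorem neg_floor_le (x : ℝ) : -(⌊x⌋ : ℝ) ≤ -x + 1 := by
  have := Int.lt_floor_add_one x
  linarith

/-- **First displayed inequality of Prop. 1.4 (iii)** as printed on p. 14:
"`μ^log(p^{⌊λ−d_I−a_I⌋}·log_p(R_I^×)) ≤ {−⌊λ−d_I−a_I⌋}·log(p) + μ^log(log_p(R_I^×))`
`= {−⌊λ−d_I−a_I⌋}·log(p) + Σ_{i∈I} μ^log(log_p(R_i^×)) + μ^log(R_I)`
`≤ {−λ + d_I + 1 + Σ_{i∈I}(a_i − 1/e_i)}·log(p) ≤ {−λ + d_I + 1 + 4·|I*|/p}·log(p)`".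
Inputs: the per-factor log-volumes `v_i = μ^log(log_p(R_i^×)) ≤ −(1/e_i)·log(p)` [Prop. 1.4 (ii)] and
`v_{R_I} = μ^log(R_I) ≤ μ^log((R_I)^~) = 0` [Prop. 1.4 (i)]; output: the printed right-hand side for
the quantity `−⌊λ−d_I−a_I⌋·log(p) + Σ_i v_i + v_{R_I}`.
[cite: Mochizuki2012, IUTchIV Prop. 1.4 (iii) p. 13] -/
theorem logVolume_bound_one (hp : p.Prime) (he : ∀ i ∈ I, 1 ≤ e i) (hIstar : Istar ⊆ I)
    (htame : ∀ i ∈ I, i ∉ Istar → e i ≤ p - 2) (lam dI vRI : ℝ) (v : ι → ℝ)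
    (hv : ∀ i ∈ I, v i ≤ -(1 / (e i : ℝ)) * Real.log p) (hvRI : vRI ≤ 0) :
    -(⌊lam - dI - ∑ i ∈ I, logRadiusA p (e i)⌋ : ℝ) * Real.log p + (∑ i ∈ I, v i + vRI)
      ≤ (-lam + dI + 1 + 4 * (Istar.card : ℝ) / p) * Real.log p := by
  have hlogp : 0 ≤ Real.log p := Real.log_nonneg (by exact_mod_cast hp.one_lt.le)
  set aI : ℝ := ∑ i ∈ I, logRadiusA p (e i) with haI
  set eI : ℝ := ∑ i ∈ I, (1 / (e i : ℝ)) with heI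
  have h1 : -(⌊lam - dI - aI⌋ : ℝ) * Real.log p ≤ (-(lam - dI - aI) + 1) * Real.log p :=
    mul_le_mul_of_nonneg_right (neg_floor_le _) hlogp
  have h2 : ∑ i ∈ I, v i ≤ -eI * Real.log p := by
    calc ∑ i ∈ I, v i ≤ ∑ i ∈ I, (-(1 / (e i : ℝ)) * Real.log p) := Finset.sum_le_sum hv
      _ = -eI * Real.log p := by
          rw [heI, ← Finset.sum_mul, ← Finset.sum_neg_distrib]
  have h3 : aI - eI ≤ 4 * (Istar.card : ℝ) / p := by
    have := sum_logRadiusA_sub_le I Istar e hp he hIstar htame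
    rwa [Finset.sum_sub_distrib] at this
  have h4 : (aI - eI) * Real.log p ≤ (4 * (Istar.card : ℝ) / p) * Real.log p :=
    mul_le_mul_of_nonneg_right h3 hlogp
  calc -(⌊lam - dI - aI⌋ : ℝ) * Real.log p + (∑ i ∈ I, v i + vRI)
      ≤ (-(lam - dI - aI) + 1) * Real.log p + (-eI * Real.log p + 0) :=
        add_le_add h1 (add_le_add h2 hvRI)
    _ = (-lam + dI + 1) * Real.log p + (aI - eI) * Real.log p := by ring
    _ ≤ (-lam + dI + 1) * Real.log p + (4 * (Istar.card : ℝ) / p) * Real.log p :=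
        add_le_add le_rfl h4
    _ = (-lam + dI + 1 + 4 * (Istar.card : ℝ) / p) * Real.log p := by ring

/-- **Second displayed inequality of Prop. 1.4 (iii)** as printed on p. 14:
"`μ^log(p^{⌊λ−d_I−a_I−b_I⌋}·(R_I)^~) ≤ {−⌊λ−d_I−a_I−b_I⌋}·log(p) + μ^log((R_I)^~)`
`≤ {−λ + d_I + a_I + b_I + 1}·log(p) ≤ {−λ + d_I + 1}·log(p) + Σ_{i∈I*} {3 + log(e_i)}`".
Input: `v = μ^log((R_I)^~) ≤ 0` [Prop. 1.4 (i): `= 0`]; output: the printed right-hand side for the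
quantity `−⌊λ−d_I−a_I−b_I⌋·log(p) + v`. [cite: Mochizuki2012, IUTchIV Prop. 1.4 (iii) p. 13] -/
theorem logVolume_bound_two (hp : p.Prime) (he : ∀ i ∈ I, 1 ≤ e i) (hIstar : Istar ⊆ I)
    (htame : ∀ i ∈ I, i ∉ Istar → e i ≤ p - 2) (lam dI vRIn : ℝ) (hvRIn : vRIn ≤ 0) :
    -(⌊lam - dI - ∑ i ∈ I, logRadiusA p (e i) - ∑ i ∈ I, logRadiusB p (e i)⌋ : ℝ) * Real.log p + vRIn
      ≤ (-lam + dI + 1) * Real.log p + ∑ i ∈ Istar, (3 + Real.log (e i)) := by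
  have hlogp : 0 ≤ Real.log p := Real.log_nonneg (by exact_mod_cast hp.one_lt.le)
  set aI : ℝ := ∑ i ∈ I, logRadiusA p (e i) with haI
  set bI : ℝ := ∑ i ∈ I, logRadiusB p (e i) with hbI
  have h1 : -(⌊lam - dI - aI - bI⌋ : ℝ) * Real.log p ≤ (-(lam - dI - aI - bI) + 1) * Real.log p :=
    mul_le_mul_of_nonneg_right (neg_floor_le _) hlogp
  have h2 : (aI + bI) * Real.log p ≤ ∑ i ∈ Istar, (3 + Real.log (e i)) := by
    have := sum_logRadius_mul_log_le I Istar e hp he hIstar htame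
    rwa [Finset.sum_add_distrib] at this
  calc -(⌊lam - dI - aI - bI⌋ : ℝ) * Real.log p + vRIn
      ≤ (-(lam - dI - aI - bI) + 1) * Real.log p + 0 := add_le_add h1 hvRIn
    _ = (-lam + dI + 1) * Real.log p + (aI + bI) * Real.log p := by ring
    _ ≤ (-lam + dI + 1) * Real.log p + ∑ i ∈ Istar, (3 + Real.log (e i)) :=
        add_le_add le_rfl h2

end Sums

end Literature.IUT.LogVolume

end
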